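import Summits.KontsevichZagierPeriods.KontsevichZagierPeriods.Theorems.TerasomaMultiplicationBetaCancellationSideDescentInstances
import Summits.KontsevichZagierPeriods.KontsevichZagierPeriods.Theorems.TerasomaMultiplicationBetaCancellationStubWeightExists
import Summits.KontsevichZagierPeriods.KontsevichZagierPeriods.Theorems.TerasomaMultiplicationBetaCancellationStubWeightMul
import Summits.KontsevichZagierPeriods.KontsevichZagierPeriods.Theorems.TerasomaMultiplicationBetaCancellationStubWeightLift
import Summits.KontsevichZagierPeriods.KontsevichZagierPeriods.Theorems.TerasomaMultiplicationBetaCancellationStubWeightSemialgebraic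
import Summits.KontsevichZagierPeriods.KontsevichZagierPeriods.Theorems.TerasomaMultiplicationBetaCancellationStubWeightConst

/-!
# Weight descent: `π`-cancellation for certificates preserving ANY bounded semialgebraic weight of the first disc coordinate

Crux lead seat c9 (`--supports` stmt-KontsevichZagierPeriods-13633, line `dirichlet-companion-to-pi`).
The restriction method of seats c7/c8 (`sideDescent`, `…SideDescent.lean`; region descent) descends a
certificate of `[π]·c ∈ relations` along the RESTRICTION operators `H_S [t, f] = [t ∩ {z 0 ∈ S}, f]`,
i.e. along multiplication of the integrand by the indicator `𝟙_S (z 0)`. This file replaces the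
indicator by an arbitrary bounded `ℚ`-semialgebraic WEIGHT `w : ℝ → ℝ`:

* `exists_weightMul` — the MULTIPLIER `M_w [t, f] = [t, w (z 0) · f]` (dimension `≥ 1`, constants
  `↦ 0`) exists as an additive endomorphism of `FormalRep` (`stub_weightExists`, p124624);
* `stub_weightMul` (p124864, imported) — `M_w` maps the closure of the **`w`-preserving generators**
  (all additivity moves; rule-(2) substitutions with `w (Φ x 0) = w (x 0)` on the domain — they may
  move `x 0` arbitrarily inside the level sets of `w`; Newton–Leibniz over bases of dimension `≥ 1`)
  into `relations`, generator by generator; `stub_weightLift` (p124939, imported) — on the pinned disc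
  family `M_w (lift (of ∘ P) c) ≡ [D, w(x)] * c`;
* `weightDescent` — **MASTER THEOREM**: if the weighted disc `[D, w(x)]` *finishes* (`[D, w]·c ∈ relations`
  and `[π]·c ∈ relations` force `c ∈ relations`) then `π`-cancellation (item 0540) holds for every
  certificate in the closure of the `w`-preserving generators; `ayoubPiCancellation_iff_weightReduction` —
  item 0540 ⟺ every relation among disc multiples is a `w`-preserving relation. Side descent is `w = 𝟙_S`.
* NEW FINISHING MECHANISM (`mem_relations_of_of_mul_mem_of_forall_prod_equivalent` +
  `stub_weightConst`, p125271): no Archimedes, no inscribed polygon — `[D, w(x)]` is worth an ALGEBRAIC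
  constant against any factor whenever `∫ w(x)·2√(1−x²) dx ∈ ℚ̄`, by two polynomial Newton–Leibniz moves;
  showcase `w₁ x = (1 + x)√(1 − x²)₊`, `[D, w₁] = 8/3`.
* `weight_ayoubPiCancellation` — **`π`-cancellation for `w₁`-preserving certificates, UNCONDITIONAL.** This
  class is incomparable with every side/region class: a `w₁`-preserving substitution may swap the two level
  points `a < 1/2 < b` of `w₁` (`(1+a)³(1−a) = (1+b)³(1−b)`) fibrewise — crossing every chord `x = q` —
  and act arbitrarily on all other coordinates, so it respects no cylinder whose disc piece finishes.
* `betaCancellation_iff_weightReduction` / `betaCancellation_of_weightReduction` — the crux as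
  `w₁`-reduction (the registered open stub `stub_weightReduction` of the skeleton, ≡ item 0540).

What is left of item 0540 after this file: a rule-(2) substitution inside an otherwise compatible
certificate that changes the value of EVERY bounded semialgebraic weight of the first disc coordinate
with finishing disc-mass (equivalently: is compatible with no `w` at all) — strictly fewer candidate
counterexamples than "crosses one chord" (seat c8).
-/

noncomputable section

-- `Summit.KontsevichZagierPeriods.KontsevichZagierPeriods.…` is the tree's mandated layout (single-conjunct summit).
set_option linter.dupNamespace false

namespace Summit.KontsevichZagierPeriods.KontsevichZagierPeriods.BetaCancellationLine

open Set
open Literature.NumberTheory.Transcendental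
open Literature.NumberTheory.Transcendental.KZ
open Summit.KontsevichZagierPeriods.KontsevichZagierPeriods.BetaCancellationNegative
  (scale_mem_relations_iff)

/-! ### The multiplier and the master theorem -/

/-- **A multiplier exists**: for a weight whose weighted companions exist there is an additive
`M : FormalRep →+ FormalRep` killing constants with `M [r] = [r.domain, w (z 0) · r.integrand]` in
every dimension `≥ 1` (free extension of a choice of companions; two companions with the same domain
and integrand are equal, `KZ.IntegralRep.ext'`). [folklore] -/
theorem exists_weightMul (w : ℝ → ℝ)
    (hex : ∀ (k : ℕ) (r : IntegralRep (k + 1)),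
      ∃ s : IntegralRep (k + 1), s.domain = r.domain ∧ s.integrand = fun z => w (z 0) * r.integrand z) :
    ∃ M : FormalRep →+ FormalRep,
      (∀ r : IntegralRep 0, M (of r) = 0) ∧
      (∀ (k : ℕ) (r s : IntegralRep (k + 1)), s.domain = r.domain →
          (s.integrand = fun z => w (z 0) * r.integrand z) → M (of r) = of s) := by
  classical
  refine ⟨FreeAbelianGroup.lift (fun s : (Σ n, IntegralRep n) => match s with
      | ⟨0, _⟩ => 0
      | ⟨k + 1, r⟩ => of (Classical.choose (hex k r))), ?_, ?_⟩
  · intro r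
    show FreeAbelianGroup.lift _ (FreeAbelianGroup.of _) = 0
    rw [FreeAbelianGroup.lift_apply_of]
  · intro k r s hd hi
    show FreeAbelianGroup.lift _ (FreeAbelianGroup.of _) = of s
    rw [FreeAbelianGroup.lift_apply_of]
    obtain ⟨hd', hi'⟩ := Classical.choose_spec (hex k r)
    exact congrArg of (IntegralRep.ext' (hd'.trans hd.symm) (hi'.trans hi.symm))

/-- The `w`-preserving generators are relations (drop the weight clause), so their closure is
`≤ relations`. [folklore] -/
theorem weightClosure_le_relations (w : ℝ → ℝ) :
    AddSubgroup.closure (domainAddRel ∪ integrandAddRel ∪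
          {x | ∃ (n : ℕ) (r r' : IntegralRep (n + 1)) (Φ : (Fin (n + 1) → ℝ) → (Fin (n + 1) → ℝ))
              (Φ' : (Fin (n + 1) → ℝ) → (Fin (n + 1) → ℝ) →L[ℝ] (Fin (n + 1) → ℝ)),
            IsSemialgebraicMapOn ℚ r.domain Φ ∧
            (∀ x ∈ r.domain, HasFDerivWithinAt Φ (Φ' x) r.domain x) ∧ Set.InjOn Φ r.domain ∧
            r'.domain = Φ '' r.domain ∧
            (∀ x ∈ r.domain, r.integrand x = r'.integrand (Φ x) * |(Φ' x).det|) ∧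
            (∀ x ∈ r.domain, w (Φ x 0) = w (x 0)) ∧
            x = of r - of r'} ∪
          fibredNewtonLeibnizRel) ≤ relations := by
  refine (AddSubgroup.closure_le relations).mpr ?_
  rintro y (((hy | hy) | hy) | hy)
  · exact domainAddRel_subset_relations hy
  · exact integrandAddRel_subset_relations hy
  · obtain ⟨k, r, r', Φ, Φ', hΦ, hΦ', hinj, hdom, hf, -, rfl⟩ := hy
    exact changeOfVariablesRel_subset_relations ⟨k + 1, r, r', Φ, Φ', hΦ, hΦ', hinj, hdom, hf, rfl⟩
  · exact newtonLeibnizRel_subset_relations (fibredNewtonLeibnizRel_subset_newtonLeibnizRel hy)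

/-- **WEIGHT DESCENT (master theorem of the multiplier method).** Let `w` be a bounded
`ℚ`-semialgebraic weight of one real variable and `D_w = [D, w(x)]` the weighted disc. If `D_w`
FINISHES — `[D_w]·c ∈ relations` and `[π]·c ∈ relations` force `c ∈ relations` — then
`π`-cancellation (item 0540) holds for every pinned disc family `P` and every certificate
`lift (of ∘ P) c` lying in the closure of the `w`-preserving generators. Side descent
(`sideDescent`, seat c8) is the case `w = 𝟙_S`. [folklore] -/
theorem weightDescent :
    ∀ (w : ℝ → ℝ), IsSemialgebraicFunOn ℚ (Set.univ : Set (Fin 1 → ℝ)) (fun x => w (x 0)) →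
    ∀ (B : ℝ), (∀ t : ℝ, |w t| ≤ B) →
    ∀ {Dw : IntegralRep 2}, Dw.domain = piDisc → (Dw.integrand = fun z => w (z 0)) →
    (∀ c : FormalRep, of Dw * c ∈ relations → of piRep * c ∈ relations → c ∈ relations) →
    ∀ (P : ∀ n : ℕ, IntegralRep n → IntegralRep (n + 2)),
      (∀ (n : ℕ) (r : IntegralRep n), (P n r).domain = {z : Fin (n + 2) → ℝ | z 0 ^ 2 + z 1 ^ 2 ≤ 1 ∧ (fun i : Fin n => z i.succ.succ) ∈ r.domain} ∧ (P n r).integrand = fun z => r.integrand (fun i : Fin n => z i.succ.succ)) →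
      ∀ (c : FormalRep),
        FreeAbelianGroup.lift (fun s : (Σ n, IntegralRep n) => of (P s.1 s.2)) c ∈
          AddSubgroup.closure (domainAddRel ∪ integrandAddRel ∪
          {x | ∃ (n : ℕ) (r r' : IntegralRep (n + 1)) (Φ : (Fin (n + 1) → ℝ) → (Fin (n + 1) → ℝ))
              (Φ' : (Fin (n + 1) → ℝ) → (Fin (n + 1) → ℝ) →L[ℝ] (Fin (n + 1) → ℝ)),
            IsSemialgebraicMapOn ℚ r.domain Φ ∧
            (∀ x ∈ r.domain, HasFDerivWithinAt Φ (Φ' x) r.domain x) ∧ Set.InjOn Φ r.domain ∧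
            r'.domain = Φ '' r.domain ∧
            (∀ x ∈ r.domain, r.integrand x = r'.integrand (Φ x) * |(Φ' x).det|) ∧
            (∀ x ∈ r.domain, w (Φ x 0) = w (x 0)) ∧
            x = of r - of r'} ∪
          fibredNewtonLeibnizRel) →
        c ∈ relations := by
  intro w hw B hB Dw hDw hDw1 hfin P hP c hc
  have hex := stub_weightExists w hw B hB
  obtain ⟨M, h0, hpin⟩ := exists_weightMul w hex
  have h1 := stub_weightMul w hw hex M h0 hpin _ hc
  have h2 := stub_weightLift w hex P hP Dw hDw hDw1 M hpin c
  have hS : of Dw * c ∈ relations := by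
    simpa using relations.add_mem h2 h1
  have hπ : of piRep * c ∈ relations := by
    have h3 := piRep_mul_sub_lift_mem_relations P hP c
    have h4 := weightClosure_le_relations w hc
    simpa using relations.add_mem h3 h4
  exact hfin c hS hπ

/-- **Disc multiples of relations are `w`-preserving relations for EVERY weight `w`**:
`[π]·relations ⊆ fibredRelations` (`stub_piMulFibred`), and a fibred change of variables
(`Φ x 0 = x 0`) trivially preserves `w (x 0)`. [folklore] -/
theorem piMul_mem_weightClosure (w : ℝ → ℝ)
    (P : ∀ n : ℕ, IntegralRep n → IntegralRep (n + 2))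
    (hP : ∀ (n : ℕ) (r : IntegralRep n),
      (P n r).domain = {z : Fin (n + 2) → ℝ | z 0 ^ 2 + z 1 ^ 2 ≤ 1 ∧ (fun i : Fin n => z i.succ.succ) ∈ r.domain} ∧
      (P n r).integrand = fun z => r.integrand (fun i : Fin n => z i.succ.succ))
    (c : FormalRep) (hc : c ∈ relations) :
    FreeAbelianGroup.lift (fun s : (Σ n, IntegralRep n) => of (P s.1 s.2)) c ∈
          AddSubgroup.closure (domainAddRel ∪ integrandAddRel ∪
          {x | ∃ (n : ℕ) (r r' : IntegralRep (n + 1)) (Φ : (Fin (n + 1) → ℝ) → (Fin (n + 1) → ℝ))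
              (Φ' : (Fin (n + 1) → ℝ) → (Fin (n + 1) → ℝ) →L[ℝ] (Fin (n + 1) → ℝ)),
            IsSemialgebraicMapOn ℚ r.domain Φ ∧
            (∀ x ∈ r.domain, HasFDerivWithinAt Φ (Φ' x) r.domain x) ∧ Set.InjOn Φ r.domain ∧
            r'.domain = Φ '' r.domain ∧
            (∀ x ∈ r.domain, r.integrand x = r'.integrand (Φ x) * |(Φ' x).det|) ∧
            (∀ x ∈ r.domain, w (Φ x 0) = w (x 0)) ∧
            x = of r - of r'} ∪
          fibredNewtonLeibnizRel) := by
  have hfib := stub_piMulFibred P hP c hc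
  rw [fibredRelations_def] at hfib
  refine AddSubgroup.closure_mono ?_ hfib
  rw [fibredGenerators_def]
  rintro y (((hy | hy) | hy) | hy)
  · exact Or.inl (Or.inl (Or.inl hy))
  · exact Or.inl (Or.inl (Or.inr hy))
  · obtain ⟨k, r, r', Φ, Φ', hΦ, hΦ', hinj, hdom, hf, h0, rfl⟩ := hy
    exact Or.inl (Or.inr ⟨k, r, r', Φ, Φ', hΦ, hΦ', hinj, hdom, hf,
      fun x hx => by rw [h0 x hx], rfl⟩)
  · exact Or.inr hy

/-- **Item 0540 ⟺ `w`-REDUCTION, for every finishing weight `w`**: `AyoubPiCancellation` holds iff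
every relation among disc multiples is a `w`-preserving relation. [folklore] -/
theorem ayoubPiCancellation_iff_weightReduction
    (w : ℝ → ℝ) (hw : IsSemialgebraicFunOn ℚ (Set.univ : Set (Fin 1 → ℝ)) (fun x => w (x 0)))
    (B : ℝ) (hB : ∀ t : ℝ, |w t| ≤ B)
    {Dw : IntegralRep 2} (hDw : Dw.domain = piDisc) (hDw1 : Dw.integrand = fun z => w (z 0))
    (hfin : ∀ c : FormalRep, of Dw * c ∈ relations → of piRep * c ∈ relations → c ∈ relations) :
    Summit.KontsevichZagierPeriods.KontsevichZagierPeriods.Theses.AyoubSpecialisation.AyoubPiCancellation ↔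
    ∀ (P : ∀ n : ℕ, IntegralRep n → IntegralRep (n + 2)),
      (∀ (n : ℕ) (r : IntegralRep n), (P n r).domain = {z : Fin (n + 2) → ℝ | z 0 ^ 2 + z 1 ^ 2 ≤ 1 ∧ (fun i : Fin n => z i.succ.succ) ∈ r.domain} ∧ (P n r).integrand = fun z => r.integrand (fun i : Fin n => z i.succ.succ)) →
      ∀ c : FormalRep,
        FreeAbelianGroup.lift (fun s : (Σ n, IntegralRep n) => of (P s.1 s.2)) c ∈ relations →
        FreeAbelianGroup.lift (fun s : (Σ n, IntegralRep n) => of (P s.1 s.2)) c ∈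
          AddSubgroup.closure (domainAddRel ∪ integrandAddRel ∪
          {x | ∃ (n : ℕ) (r r' : IntegralRep (n + 1)) (Φ : (Fin (n + 1) → ℝ) → (Fin (n + 1) → ℝ))
              (Φ' : (Fin (n + 1) → ℝ) → (Fin (n + 1) → ℝ) →L[ℝ] (Fin (n + 1) → ℝ)),
            IsSemialgebraicMapOn ℚ r.domain Φ ∧
            (∀ x ∈ r.domain, HasFDerivWithinAt Φ (Φ' x) r.domain x) ∧ Set.InjOn Φ r.domain ∧
            r'.domain = Φ '' r.domain ∧
            (∀ x ∈ r.domain, r.integrand x = r'.integrand (Φ x) * |(Φ' x).det|) ∧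
            (∀ x ∈ r.domain, w (Φ x 0) = w (x 0)) ∧
            x = of r - of r'} ∪
          fibredNewtonLeibnizRel) := by
  constructor
  · intro h P hP c hc
    exact piMul_mem_weightClosure w P hP c (h P hP c hc)
  · intro h P hP c hc
    exact weightDescent w hw B hB hDw hDw1 hfin P hP c (h P hP c hc)

/-! ### Finishing by a constant: `[X]·c ≡ scale κ c` whenever `s × X ∼ κ·s` for every `s` -/

/-- **`[X]·c ≡ scale κ c` modulo relations** from an equivalence `s × X ∼ κ·s` for every factor `s`
(biadditivity and commutativity of `×` modulo relations; general form of
`of_triangle_mul_sub_scale_mem`, seat c7). [folklore] -/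
theorem of_mul_sub_scale_mem_of_forall_prod_equivalent {d : ℕ} (X : IntegralRep d) {κ : ℝ}
    (hκ : IsAlgebraic ℚ κ)
    (hX : ∀ (m : ℕ) (s : IntegralRep m), Equivalent (s.prod X) (s.constMul κ hκ))
    (c : FormalRep) :
    of X * c - scale κ hκ c ∈ relations := by
  induction c using FreeAbelianGroup.induction_on with
  | zero => simp [relations.zero_mem]
  | of x =>
    obtain ⟨m, s⟩ := x
    change of X * of s - scale _ _ (of s) ∈ relations
    rw [scale_of]
    have h1 := of_mul_of_sub_of_mul_of_mem_relations X s
    have h2 : of s * of X - of (s.constMul κ hκ) ∈ relations := by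
      rw [of_mul_of]; exact hX m s
    have e : of X * of s - of (s.constMul κ hκ) =
        (of X * of s - of s * of X) + (of s * of X - of (s.constMul κ hκ)) := by
      abel
    rw [e]
    exact relations.add_mem h1 h2
  | neg x ih =>
    have e : of X * -FreeAbelianGroup.of x - scale κ hκ (-FreeAbelianGroup.of x) =
        -(of X * FreeAbelianGroup.of x - scale κ hκ (FreeAbelianGroup.of x)) := by
      rw [mul_neg, map_neg]; abel
    rw [e]
    exact relations.neg_mem ih
  | add x y hx hy =>
    have e : of X * (x + y) - scale κ hκ (x + y) =
        (of X * x - scale κ hκ x) + (of X * y - scale κ hκ y) := by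
      rw [mul_add, map_add]; abel
    rw [e]
    exact relations.add_mem hx hy

/-- **A representation worth a non-zero algebraic constant finishes**: if `s × X ∼ κ·s` for every
`s` with `κ ≠ 0` algebraic, then `[X]·c ∈ relations → c ∈ relations`
(`of_mul_sub_scale_mem_of_forall_prod_equivalent` and `scale_mem_relations_iff`). [folklore] -/
theorem mem_relations_of_of_mul_mem_of_forall_prod_equivalent {d : ℕ} (X : IntegralRep d) {κ : ℝ}
    (hκ : IsAlgebraic ℚ κ) (hκ0 : κ ≠ 0)
    (hX : ∀ (m : ℕ) (s : IntegralRep m), Equivalent (s.prod X) (s.constMul κ hκ))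
    (c : FormalRep) (hc : of X * c ∈ relations) : c ∈ relations := by
  have h2 := of_mul_sub_scale_mem_of_forall_prod_equivalent X hκ hX c
  have h3 : scale κ hκ c ∈ relations := by
    have := relations.sub_mem hc h2
    rwa [sub_sub_cancel] at this
  exact (scale_mem_relations_iff hκ hκ0 c).1 h3

/-! ### The showcase weight `w₁ x = (1 + x)√(1 − x²)` -/

/-- **`π`-CANCELLATION FOR `w₁`-PRESERVING CERTIFICATES** (item 0540 restricted to the closure of the
generators preserving the weight `w₁ (z 0) = (1 + z 0)√(1 − (z 0)²)`; UNCONDITIONAL — the five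
delegated stubs are tree theorems): the weighted disc `[D, w₁]` is worth `8/3 ≠ 0` against any factor
(`stub_weightConst`), so it finishes, and `weightDescent` applies. This class is incomparable with
every side/region class of seats c7/c8 (level-swapping substitutions cross every chord). [folklore] -/
theorem weight_ayoubPiCancellation :
    ∀ (P : ∀ n : ℕ, IntegralRep n → IntegralRep (n + 2)),
      (∀ (n : ℕ) (r : IntegralRep n), (P n r).domain = {z : Fin (n + 2) → ℝ | z 0 ^ 2 + z 1 ^ 2 ≤ 1 ∧ (fun i : Fin n => z i.succ.succ) ∈ r.domain} ∧ (P n r).integrand = fun z => r.integrand (fun i : Fin n => z i.succ.succ)) →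
      ∀ c : FormalRep,
        FreeAbelianGroup.lift (fun s : (Σ n, IntegralRep n) => of (P s.1 s.2)) c ∈
          AddSubgroup.closure (domainAddRel ∪ integrandAddRel ∪
          {x | ∃ (n : ℕ) (r r' : IntegralRep (n + 1)) (Φ : (Fin (n + 1) → ℝ) → (Fin (n + 1) → ℝ))
              (Φ' : (Fin (n + 1) → ℝ) → (Fin (n + 1) → ℝ) →L[ℝ] (Fin (n + 1) → ℝ)),
            IsSemialgebraicMapOn ℚ r.domain Φ ∧
            (∀ x ∈ r.domain, HasFDerivWithinAt Φ (Φ' x) r.domain x) ∧ Set.InjOn Φ r.domain ∧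
            r'.domain = Φ '' r.domain ∧
            (∀ x ∈ r.domain, r.integrand x = r'.integrand (Φ x) * |(Φ' x).det|) ∧
            (∀ x ∈ r.domain, (1 + Φ x 0) * Real.sqrt (1 - Φ x 0 ^ 2) = (1 + x 0) * Real.sqrt (1 - x 0 ^ 2)) ∧
            x = of r - of r'} ∪
          fibredNewtonLeibnizRel) →
        c ∈ relations := by
  obtain ⟨Dw, hDw, hDw1, hDwc⟩ := stub_weightConst
  -- `8/3` is algebraic (rational); kept local (the tree's `isAlgebraic_eight_div_three` lives in an
  -- unrelated route module)
  have h83 : IsAlgebraic ℚ (8 / 3 : ℝ) := by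
    have h := isAlgebraic_algebraMap (R := ℚ) (A := ℝ) (8 / 3 : ℚ)
    have e : (algebraMap ℚ ℝ) (8 / 3 : ℚ) = (8 / 3 : ℝ) := by
      rw [eq_ratCast]; push_cast; ring
    rwa [e] at h
  have hfin : ∀ c : FormalRep, of Dw * c ∈ relations → of piRep * c ∈ relations → c ∈ relations :=
    fun c hc _ => mem_relations_of_of_mul_mem_of_forall_prod_equivalent Dw h83
      (by norm_num) (hDwc h83) c hc
  exact weightDescent (fun t : ℝ => (1 + t) * Real.sqrt (1 - t ^ 2)) stub_weightSemialgebraic.1 2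
    stub_weightSemialgebraic.2 hDw hDw1 hfin

/-- **Item 0540 ⟺ `w₁`-REDUCTION.** [folklore] -/
theorem ayoubPiCancellation_iff_weightReduction_w₁ :
    Summit.KontsevichZagierPeriods.KontsevichZagierPeriods.Theses.AyoubSpecialisation.AyoubPiCancellation ↔
    ∀ (P : ∀ n : ℕ, IntegralRep n → IntegralRep (n + 2)),
      (∀ (n : ℕ) (r : IntegralRep n), (P n r).domain = {z : Fin (n + 2) → ℝ | z 0 ^ 2 + z 1 ^ 2 ≤ 1 ∧ (fun i : Fin n => z i.succ.succ) ∈ r.domain} ∧ (P n r).integrand = fun z => r.integrand (fun i : Fin n => z i.succ.succ)) →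
      ∀ c : FormalRep,
        FreeAbelianGroup.lift (fun s : (Σ n, IntegralRep n) => of (P s.1 s.2)) c ∈ relations →
        FreeAbelianGroup.lift (fun s : (Σ n, IntegralRep n) => of (P s.1 s.2)) c ∈
          AddSubgroup.closure (domainAddRel ∪ integrandAddRel ∪
          {x | ∃ (n : ℕ) (r r' : IntegralRep (n + 1)) (Φ : (Fin (n + 1) → ℝ) → (Fin (n + 1) → ℝ))
              (Φ' : (Fin (n + 1) → ℝ) → (Fin (n + 1) → ℝ) →L[ℝ] (Fin (n + 1) → ℝ)),
            IsSemialgebraicMapOn ℚ r.domain Φ ∧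
            (∀ x ∈ r.domain, HasFDerivWithinAt Φ (Φ' x) r.domain x) ∧ Set.InjOn Φ r.domain ∧
            r'.domain = Φ '' r.domain ∧
            (∀ x ∈ r.domain, r.integrand x = r'.integrand (Φ x) * |(Φ' x).det|) ∧
            (∀ x ∈ r.domain, (1 + Φ x 0) * Real.sqrt (1 - Φ x 0 ^ 2) = (1 + x 0) * Real.sqrt (1 - x 0 ^ 2)) ∧
            x = of r - of r'} ∪
          fibredNewtonLeibnizRel) := by
  constructor
  · intro h P hP c hc
    exact piMul_mem_weightClosure (fun t : ℝ => (1 + t) * Real.sqrt (1 - t ^ 2)) P hP c (h P hP c hc)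
  · intro h P hP c hc
    exact weight_ayoubPiCancellation P hP c (h P hP c hc)

/-- **THE CRUX ⟺ `w₁`-REDUCTION**: `BetaCancellation` (stmt-13633) holds iff every relation among
disc multiples can be re-certified by moves whose rule-(2) substitutions preserve the weight
`(1 + x)√(1 − x²)` of the first disc coordinate — the open core after seat c9 (≡ item 0540).
[folklore] -/
theorem betaCancellation_iff_weightReduction :
    Summit.KontsevichZagierPeriods.KontsevichZagierPeriods.Theses.TerasomaMultiplication.BetaCancellation ↔
    ∀ (P : ∀ n : ℕ, IntegralRep n → IntegralRep (n + 2)),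
      (∀ (n : ℕ) (r : IntegralRep n), (P n r).domain = {z : Fin (n + 2) → ℝ | z 0 ^ 2 + z 1 ^ 2 ≤ 1 ∧ (fun i : Fin n => z i.succ.succ) ∈ r.domain} ∧ (P n r).integrand = fun z => r.integrand (fun i : Fin n => z i.succ.succ)) →
      ∀ c : FormalRep,
        FreeAbelianGroup.lift (fun s : (Σ n, IntegralRep n) => of (P s.1 s.2)) c ∈ relations →
        FreeAbelianGroup.lift (fun s : (Σ n, IntegralRep n) => of (P s.1 s.2)) c ∈
          AddSubgroup.closure (domainAddRel ∪ integrandAddRel ∪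
          {x | ∃ (n : ℕ) (r r' : IntegralRep (n + 1)) (Φ : (Fin (n + 1) → ℝ) → (Fin (n + 1) → ℝ))
              (Φ' : (Fin (n + 1) → ℝ) → (Fin (n + 1) → ℝ) →L[ℝ] (Fin (n + 1) → ℝ)),
            IsSemialgebraicMapOn ℚ r.domain Φ ∧
            (∀ x ∈ r.domain, HasFDerivWithinAt Φ (Φ' x) r.domain x) ∧ Set.InjOn Φ r.domain ∧
            r'.domain = Φ '' r.domain ∧
            (∀ x ∈ r.domain, r.integrand x = r'.integrand (Φ x) * |(Φ' x).det|) ∧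
            (∀ x ∈ r.domain, (1 + Φ x 0) * Real.sqrt (1 - Φ x 0 ^ 2) = (1 + x 0) * Real.sqrt (1 - x 0 ^ 2)) ∧
            x = of r - of r'} ∪
          fibredNewtonLeibnizRel) :=
  betaCancellation_iff_ayoubPiCancellation.trans ayoubPiCancellation_iff_weightReduction_w₁


/-- **Item 0540 in its closed-term form ⟺ `w₁`-reduction** (`KZ.PiCancellation`, through the landed
bridge `stub_ayoubBridge`). [folklore] -/
theorem piCancellation_iff_weightReduction_w₁ :
    KZ.PiCancellation ↔
    ∀ (P : ∀ n : ℕ, IntegralRep n → IntegralRep (n + 2)),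
      (∀ (n : ℕ) (r : IntegralRep n), (P n r).domain = {z : Fin (n + 2) → ℝ | z 0 ^ 2 + z 1 ^ 2 ≤ 1 ∧ (fun i : Fin n => z i.succ.succ) ∈ r.domain} ∧ (P n r).integrand = fun z => r.integrand (fun i : Fin n => z i.succ.succ)) →
      ∀ c : FormalRep,
        FreeAbelianGroup.lift (fun s : (Σ n, IntegralRep n) => of (P s.1 s.2)) c ∈ relations →
        FreeAbelianGroup.lift (fun s : (Σ n, IntegralRep n) => of (P s.1 s.2)) c ∈
          AddSubgroup.closure (domainAddRel ∪ integrandAddRel ∪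
          {x | ∃ (n : ℕ) (r r' : IntegralRep (n + 1)) (Φ : (Fin (n + 1) → ℝ) → (Fin (n + 1) → ℝ))
              (Φ' : (Fin (n + 1) → ℝ) → (Fin (n + 1) → ℝ) →L[ℝ] (Fin (n + 1) → ℝ)),
            IsSemialgebraicMapOn ℚ r.domain Φ ∧
            (∀ x ∈ r.domain, HasFDerivWithinAt Φ (Φ' x) r.domain x) ∧ Set.InjOn Φ r.domain ∧
            r'.domain = Φ '' r.domain ∧
            (∀ x ∈ r.domain, r.integrand x = r'.integrand (Φ x) * |(Φ' x).det|) ∧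
            (∀ x ∈ r.domain, (1 + Φ x 0) * Real.sqrt (1 - Φ x 0 ^ 2) = (1 + x 0) * Real.sqrt (1 - x 0 ^ 2)) ∧
            x = of r - of r'} ∪
          fibredNewtonLeibnizRel) :=
  stub_ayoubBridge.symm.trans ayoubPiCancellation_iff_weightReduction_w₁

/-- **The crux from `w₁`-reduction** (closing term the day the open core lands). [folklore] -/
theorem betaCancellation_of_weightReduction
    (h : ∀ (P : ∀ n : ℕ, IntegralRep n → IntegralRep (n + 2)),
      (∀ (n : ℕ) (r : IntegralRep n), (P n r).domain = {z : Fin (n + 2) → ℝ | z 0 ^ 2 + z 1 ^ 2 ≤ 1 ∧ (fun i : Fin n => z i.succ.succ) ∈ r.domain} ∧ (P n r).integrand = fun z => r.integrand (fun i : Fin n => z i.succ.succ)) →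
      ∀ c : FormalRep,
        FreeAbelianGroup.lift (fun s : (Σ n, IntegralRep n) => of (P s.1 s.2)) c ∈ relations →
        FreeAbelianGroup.lift (fun s : (Σ n, IntegralRep n) => of (P s.1 s.2)) c ∈
          AddSubgroup.closure (domainAddRel ∪ integrandAddRel ∪
          {x | ∃ (n : ℕ) (r r' : IntegralRep (n + 1)) (Φ : (Fin (n + 1) → ℝ) → (Fin (n + 1) → ℝ))
              (Φ' : (Fin (n + 1) → ℝ) → (Fin (n + 1) → ℝ) →L[ℝ] (Fin (n + 1) → ℝ)),
            IsSemialgebraicMapOn ℚ r.domain Φ ∧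
            (∀ x ∈ r.domain, HasFDerivWithinAt Φ (Φ' x) r.domain x) ∧ Set.InjOn Φ r.domain ∧
            r'.domain = Φ '' r.domain ∧
            (∀ x ∈ r.domain, r.integrand x = r'.integrand (Φ x) * |(Φ' x).det|) ∧
            (∀ x ∈ r.domain, (1 + Φ x 0) * Real.sqrt (1 - Φ x 0 ^ 2) = (1 + x 0) * Real.sqrt (1 - x 0 ^ 2)) ∧
            x = of r - of r'} ∪
          fibredNewtonLeibnizRel)) :
    Summit.KontsevichZagierPeriods.KontsevichZagierPeriods.Theses.TerasomaMultiplication.BetaCancellation :=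
  betaCancellation_iff_weightReduction.2 h

end Summit.KontsevichZagierPeriods.KontsevichZagierPeriods.BetaCancellationLine
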